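import Summits.QuantumFields.YangMills.Theorems.EntropyBudgetEquipartitionCovTransferTorus
import Summits.QuantumFields.YangMills.Theses.EntropyBudgetEquipartition
import HarnessLib

/-!
# Route `EntropyBudgetEquipartition`, crux `EntropyBudgetTransfer` (stmt-QuantumFields-22401) — helper «KT3 → KT»,
# part 3: the crux REDUCED to reference pair laws (the interface KT2 + KT3 must deliver)

HONEST LABEL: a reduction of a RECORD-label rung crux (R2ξ-G, `WeakCouplingRates.XiPow`, an UPPER bound on the lattice
gap); the Yang–Mills mass gap is NOT proved by any of this, and neither is the crux.

`twoSidedLaw_of_referencePairs` — fix a compact `G` and a lattice representation `r`. SUPPOSE that for some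
`κ₁, A, σ > 0`, `C₁`, `β₀`: for every `β ≥ β₀` and `1 ≤ n ≤ 2β^A`, eventually in the torus size `L`, there is a probability
space `(E', Q)` with a REFERENCE PAIR `0 ≤ X', Y' ≤ 2Nβ` (measurable) such that
(i) the joint law of `(β c₀, β c_n)` under the torus Wilson state `μ_{β,L+1}` is `β^{−κ₁}`-close to the joint law of
`(X', Y')` on measurable test functions of the pair bounded by `1` (e.g. from a relative-entropy bound `½ β^{−2κ₁}` by
part 1's `abs_integral_pair_sub_le_sqrt_klDiv_map`), (ii) `|Cov_Q(X', Y') − σ C(n)²| ≤ C₁ β^{−κ₁}`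
(`C(n) = curvaturePlaquetteCorr 4 n`), (iii) `Q{m_β < X'} + Q{m_β < Y'} ≤ β^{−3}` at the level `m_β = (log β)² + 1`.
THEN the two-sided free-gluon law — the conclusion of `EntropyBudgetTransfer` at `(G, r)` — holds with exponent
`min(κ₁/2, 1)`: part 2's `covTransfer_torus` at `m = m_β` (its `μ`-tail term `C β^{κ+2} e^{−m_β/2}` is `≤ C β^{−1}` once
`log β ≥ 2(κ + 3)`, and `m_β² β^{−κ₁} ≤ c β^{−κ₁/2}` by `log β ≤ β^ε/ε`).  `entropyBudgetTransfer_of_referencePairs` — the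
same hypothesis at every compact simple `G` and every `r` gives the crux `EntropyBudgetTransfer` itself (its K1
hypothesis is then idle; cf. the tree's `TwoSignedSource.entropyBudgetTransfer_iff_twoSidedLaw`).

So the crux is REDUCED to producing such reference pairs volume-uniformly: the block entropy budget (KT2), its
localisation to the pair (KT3: Csiszár + Pinsker, tree `klDiv_map_fst_add_klDiv_map_snd_le`, part 1) and the
Gaussian cumulant `Cov = σ C(n)² + O(β^{−κ})` with chi-square tails — none of which is here.  Written by the width
seat 2/3 of line `ym-line-ebe-p1` as `--supports stmt-QuantumFields-22401`; no registered stub is restated.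
References: Boucheron–Lugosi–Massart 2013 Thm. 4.19 [BoucheronLugosiMassart2013]; Fröhlich–Israel–Lieb–Simon 1978
Thm. 4.1 [FrohlichIsraelLiebSimon1978].
-/

set_option autoImplicit false

noncomputable section

open MeasureTheory Set Filter

namespace Summit.QuantumFields.YangMills.Theorems.EntropyBudgetEquipartition.CovTransfer

open Literature.MathematicalPhysics.QuantumFieldTheory Literature.MathematicalPhysics.QuantumLattice
open Summit.QuantumFields.YangMills.Theorems.WeakCouplingRates

/-! ### Real-analysis bookkeeping for the level `m_β = (log β)² + 1` -/

/-- `((log β)² + 1)² ≤ (64/κ₁² + 1)² β^{κ₁/2}` for `β ≥ 1`, `κ₁ > 0` (`log β ≤ β^ε/ε` at `ε = κ₁/8`). [folklore] -/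
theorem logSq_add_one_sq_le {β κ₁ : ℝ} (hβ : 1 ≤ β) (hκ₁ : 0 < κ₁) :
    (Real.log β ^ 2 + 1) ^ 2 ≤ ((8 / κ₁) ^ 2 + 1) ^ 2 * β ^ (κ₁ / 2) := by
  have hβ0 : 0 < β := lt_of_lt_of_le one_pos hβ
  have hε : 0 < κ₁ / 8 := by positivity
  have hlog0 : 0 ≤ Real.log β := Real.log_nonneg hβ
  have hl : Real.log β ≤ β ^ (κ₁ / 8) / (κ₁ / 8) := Real.log_le_rpow_div hβ0.le hε
  have hp0 : 0 < β ^ (κ₁ / 8) := Real.rpow_pos_of_pos hβ0 _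
  have hp1 : 1 ≤ β ^ (κ₁ / 8) := Real.one_le_rpow hβ (by positivity)
  have e1 : β ^ (κ₁ / 8) / (κ₁ / 8) = (8 / κ₁) * β ^ (κ₁ / 8) := by field_simp
  rw [e1] at hl
  -- `log² β + 1 ≤ ((8/κ₁)² + 1) β^{κ₁/4}`
  have hsq : Real.log β ^ 2 ≤ (8 / κ₁) ^ 2 * (β ^ (κ₁ / 8)) ^ 2 := by
    rw [← mul_pow]; exact pow_le_pow_left₀ hlog0 hl 2
  have e2 : (β ^ (κ₁ / 8)) ^ 2 = β ^ (κ₁ / 4) := by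
    rw [← Real.rpow_natCast, ← Real.rpow_mul hβ0.le]; norm_num; ring_nf
  rw [e2] at hsq
  have hq1 : 1 ≤ β ^ (κ₁ / 4) := Real.one_le_rpow hβ (by positivity)
  have hm : Real.log β ^ 2 + 1 ≤ ((8 / κ₁) ^ 2 + 1) * β ^ (κ₁ / 4) := by nlinarith [sq_nonneg (8 / κ₁)]
  have hm0 : 0 ≤ Real.log β ^ 2 + 1 := by positivity
  have e3 : (β ^ (κ₁ / 4)) ^ 2 = β ^ (κ₁ / 2) := by
    rw [← Real.rpow_natCast, ← Real.rpow_mul hβ0.le]; norm_num; ring_nf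
  calc (Real.log β ^ 2 + 1) ^ 2 ≤ (((8 / κ₁) ^ 2 + 1) * β ^ (κ₁ / 4)) ^ 2 := pow_le_pow_left₀ hm0 hm 2
    _ = ((8 / κ₁) ^ 2 + 1) ^ 2 * β ^ (κ₁ / 2) := by rw [mul_pow, e3]

/-- The `μ`-tail term at the level `m_β`: `β^{κ+2} e^{−((log β)²+1)/2} ≤ β^{−1}` once `log β ≥ 2(κ+3)`. [folklore] -/
theorem pow_mul_exp_neg_logSq_le {β : ℝ} {κ : ℕ} (hβ : 1 ≤ β) (hlog : 2 * ((κ : ℝ) + 3) ≤ Real.log β) :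
    β ^ (κ + 2) * Real.exp (-((Real.log β ^ 2 + 1) / 2)) ≤ β ^ (-(1 : ℝ)) := by
  have hβ0 : 0 < β := lt_of_lt_of_le one_pos hβ
  have hlog0 : 0 ≤ Real.log β := Real.log_nonneg hβ
  have e1 : β ^ (κ + 2) = Real.exp (((κ : ℝ) + 2) * Real.log β) := by
    rw [← Real.rpow_natCast, Real.rpow_def_of_pos hβ0]; congr 1; push_cast; ring
  have e2 : β ^ (-(1 : ℝ)) = Real.exp (-Real.log β) := by
    rw [Real.rpow_def_of_pos hβ0]; congr 1; ring
  rw [e1, e2, ← Real.exp_add]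
  apply Real.exp_le_exp.2
  -- `(κ+2) log β − (log²β + 1)/2 ≤ −log β` since `log² β ≥ 2(κ+3) log β`
  have h1 : 2 * ((κ : ℝ) + 3) * Real.log β ≤ Real.log β ^ 2 := by
    rw [sq]; exact mul_le_mul_of_nonneg_right hlog hlog0
  nlinarith

/-! ### The two-sided law from reference pair laws -/

variable {G : Type} [Group G] [TopologicalSpace G] [IsTopologicalGroup G] [CompactSpace G]
  [MeasurableSpace G] [BorelSpace G]

/-- **The two-sided free-gluon law at `(G, r)` from reference pair laws** (crux `EntropyBudgetTransfer` reduced to the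
output of KT2 + KT3): see the module docstring for the hypothesis (i)–(iii); the conclusion is the conclusion of
`EntropyBudgetTransfer` at `(G, r)`, with exponent `min(κ₁/2, 1)` and the hypothesis' own `A`, `σ`.
[cite: BoucheronLugosiMassart2013, §4.11 Thm. 4.19] -/
theorem twoSidedLaw_of_referencePairs (r : LatticeRep G)
    (href : ∃ κ₁ A σ C₁ β₀ : ℝ, 0 < κ₁ ∧ 0 < A ∧ 0 < σ ∧ ∀ β : ℝ, β₀ ≤ β → ∀ n : ℕ, 1 ≤ n → (n : ℝ) ≤ 2 * β ^ A →
      ∀ᶠ L : ℕ in atTop, ∃ (E' : Type) (_ : MeasurableSpace E') (Q : Measure E') (_ : IsProbabilityMeasure Q)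
        (X' Y' : E' → ℝ), Measurable X' ∧ Measurable Y' ∧ (∀ e, 0 ≤ X' e ∧ X' e ≤ 2 * r.N * β) ∧
        (∀ e, 0 ≤ Y' e ∧ Y' e ≤ 2 * r.N * β) ∧
        (∀ h : ℝ × ℝ → ℝ, Measurable h → (∀ z, |h z| ≤ 1) →
          |wilsonExpectation (L := L + 1) r.ρ β (toTorusObservable (L + 1) fun U =>
              h (β * plaqCost0 (d := 4) r.ρ 1 2 U, β * plaqCost0 (d := 4) r.ρ 1 2 (timeShiftLG (G := G) n U))) -
            ∫ e, h (X' e, Y' e) ∂Q| ≤ β ^ (-κ₁)) ∧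
        |(∫ e, X' e * Y' e ∂Q - (∫ e, X' e ∂Q) * (∫ e, Y' e ∂Q)) -
            σ * (curvaturePlaquetteCorr (d := 4) (by norm_num) (n : ℤ)) ^ 2| ≤ C₁ * β ^ (-κ₁) ∧
        Q.real {e | Real.log β ^ 2 + 1 < X' e} + Q.real {e | Real.log β ^ 2 + 1 < Y' e} ≤ β ^ (-(3 : ℝ))) :
    ∃ κ A C σ β₀ : ℝ, 0 < κ ∧ 0 < A ∧ 0 < σ ∧ ∀ β : ℝ, β₀ ≤ β → ∀ n : ℕ, 1 ≤ n → (n : ℝ) ≤ 2 * β ^ A →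
      ∀ᶠ L : ℕ in atTop, |β ^ 2 * (wilsonExpectation (L := L + 1) r.ρ β (toTorusObservable (L + 1) fun U =>
          plaqCost0 (d := 4) r.ρ 1 2 U * plaqCost0 (d := 4) r.ρ 1 2 (timeShiftLG (G := G) n U)) -
        wilsonExpectation (L := L + 1) r.ρ β (toTorusObservable (L + 1) (plaqCost0 (d := 4) r.ρ 1 2)) *
          wilsonExpectation (L := L + 1) r.ρ β (toTorusObservable (L + 1) fun U =>
            plaqCost0 (d := 4) r.ρ 1 2 (timeShiftLG (G := G) n U))) -
        σ * (curvaturePlaquetteCorr (d := 4) (by norm_num) (n : ℤ)) ^ 2| ≤ C * β ^ (-κ) := by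
  obtain ⟨κ₁, A, σ, C₁, β₀, hκ₁, hA, hσ, H⟩ := href
  obtain ⟨C, hC, κ, T⟩ := covTransfer_torus r
  -- constants
  set K : ℝ := ((8 / κ₁) ^ 2 + 1) ^ 2 with hK
  have hK0 : 0 ≤ K := by positivity
  refine ⟨min (κ₁ / 2) 1, A, 3 * K + |C₁| + C + 8 * (r.N : ℝ) ^ 2, σ,
    max β₀ (max 1 (Real.exp (2 * ((κ : ℝ) + 3)))), by positivity, hA, hσ, ?_⟩
  intro β hβ n hn1 hnA
  have hβ₀ : β₀ ≤ β := (le_max_left _ _).trans hβ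
  have hβ1 : 1 ≤ β := (le_max_left _ _).trans ((le_max_right _ _).trans hβ)
  have hβe : Real.exp (2 * ((κ : ℝ) + 3)) ≤ β := (le_max_right _ _).trans ((le_max_right _ _).trans hβ)
  have hβ0 : 0 < β := lt_of_lt_of_le one_pos hβ1
  have hlog : 2 * ((κ : ℝ) + 3) ≤ Real.log β := by
    rw [← Real.log_exp (2 * ((κ : ℝ) + 3))]; exact Real.log_le_log (Real.exp_pos _) hβe
  filter_upwards [H β hβ₀ n hn1 hnA, eventually_ge_atTop 1] with L hL hL1
  obtain ⟨E', mE', Q, hQ, X', Y', hX'm, hY'm, hX'b, hY'b, hclose, hcov, htails⟩ := hL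
  set m : ℝ := Real.log β ^ 2 + 1 with hm
  have hm0 : 0 < m := by positivity
  have hT := T L hL1 β hβ1 n Q X' Y' hX'm hY'm (fun e => (hX'b e).1) (fun e => (hX'b e).2)
    (fun e => (hY'b e).1) (fun e => (hY'b e).2) m (β ^ (-κ₁)) hm0 hclose
  -- the four error terms
  have t1 : 3 * m ^ 2 * β ^ (-κ₁) ≤ 3 * K * β ^ (-(κ₁ / 2)) := by
    have h1 : m ^ 2 ≤ K * β ^ (κ₁ / 2) := logSq_add_one_sq_le hβ1 hκ₁
    have h2 : β ^ (κ₁ / 2) * β ^ (-κ₁) = β ^ (-(κ₁ / 2)) := by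
      rw [← Real.rpow_add hβ0]; congr 1; ring
    have h3 : 0 ≤ β ^ (-κ₁) := (Real.rpow_pos_of_pos hβ0 _).le
    calc 3 * m ^ 2 * β ^ (-κ₁) ≤ 3 * (K * β ^ (κ₁ / 2)) * β ^ (-κ₁) := by gcongr
      _ = 3 * K * β ^ (-(κ₁ / 2)) := by rw [← h2]; ring
  have t2 : C * β ^ (κ + 2) * Real.exp (-(m / 2)) ≤ C * β ^ (-(1 : ℝ)) := by
    have := pow_mul_exp_neg_logSq_le (κ := κ) hβ1 hlog
    rw [hm, mul_assoc]
    exact mul_le_mul_of_nonneg_left this hC.le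
  have t3 : 8 * ((r.N : ℝ) * β) ^ 2 * (Q.real {e | m < X' e} + Q.real {e | m < Y' e}) ≤
      8 * (r.N : ℝ) ^ 2 * β ^ (-(1 : ℝ)) := by
    have h1 : 8 * ((r.N : ℝ) * β) ^ 2 * (Q.real {e | m < X' e} + Q.real {e | m < Y' e}) ≤
        8 * ((r.N : ℝ) * β) ^ 2 * β ^ (-(3 : ℝ)) := mul_le_mul_of_nonneg_left htails (by positivity)
    have h2 : ((r.N : ℝ) * β) ^ 2 * β ^ (-(3 : ℝ)) = (r.N : ℝ) ^ 2 * β ^ (-(1 : ℝ)) := by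
      rw [mul_pow, mul_assoc]
      congr 1
      rw [← Real.rpow_natCast, ← Real.rpow_add hβ0]; norm_num
    calc _ ≤ 8 * ((r.N : ℝ) * β) ^ 2 * β ^ (-(3 : ℝ)) := h1
      _ = 8 * (r.N : ℝ) ^ 2 * β ^ (-(1 : ℝ)) := by rw [mul_assoc, h2, ← mul_assoc]
  have t4 : C₁ * β ^ (-κ₁) ≤ |C₁| * β ^ (-(κ₁ / 2)) :=
    mul_le_mul (le_abs_self C₁) (Real.rpow_le_rpow_of_exponent_le hβ1 (by linarith))
      (Real.rpow_pos_of_pos hβ0 _).le (abs_nonneg _)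
  -- monotonicity in the exponent: `β^{-a} ≤ β^{-min(κ₁/2,1)}` for `a ∈ {κ₁/2, 1}`
  have p1 : β ^ (-(κ₁ / 2)) ≤ β ^ (-min (κ₁ / 2) 1) :=
    Real.rpow_le_rpow_of_exponent_le hβ1 (by simp)
  have p2 : β ^ (-(1 : ℝ)) ≤ β ^ (-min (κ₁ / 2) 1) :=
    Real.rpow_le_rpow_of_exponent_le hβ1 (by simp)
  -- combine: `|a − c| ≤ |a − b| + |b − c|`
  have step := abs_sub_le
    (β ^ 2 * (wilsonExpectation (L := L + 1) r.ρ β (toTorusObservable (L + 1) fun U =>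
          plaqCost0 (d := 4) r.ρ 1 2 U * plaqCost0 (d := 4) r.ρ 1 2 (timeShiftLG (G := G) n U)) -
        wilsonExpectation (L := L + 1) r.ρ β (toTorusObservable (L + 1) (plaqCost0 (d := 4) r.ρ 1 2)) *
          wilsonExpectation (L := L + 1) r.ρ β (toTorusObservable (L + 1) fun U =>
            plaqCost0 (d := 4) r.ρ 1 2 (timeShiftLG (G := G) n U))))
    (∫ e, X' e * Y' e ∂Q - (∫ e, X' e ∂Q) * (∫ e, Y' e ∂Q))
    (σ * (curvaturePlaquetteCorr (d := 4) (by norm_num) (n : ℤ)) ^ 2)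
  have hKβ : 0 ≤ 3 * K := by positivity
  have hN : 0 ≤ 8 * (r.N : ℝ) ^ 2 := by positivity
  nlinarith [mul_le_mul_of_nonneg_left p1 hKβ, mul_le_mul_of_nonneg_left p1 (abs_nonneg C₁),
    mul_le_mul_of_nonneg_left p2 hC.le, mul_le_mul_of_nonneg_left p2 hN, hT, hcov, step, t1, t2, t3, t4]

/-- **The crux `EntropyBudgetTransfer` from reference pair laws at every `(G, r)`** (its K1 hypothesis is then idle).
A reduction of a RECORD-label rung crux to the genuine output of KT2 + KT3; NOT the Clay mass gap.
[cite: BoucheronLugosiMassart2013, §4.11 Thm. 4.19] -/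
theorem entropyBudgetTransfer_of_referencePairs
    (href : ∀ (G : Type) [Group G] [TopologicalSpace G] [IsTopologicalGroup G] [CompactSpace G], IsCompactSimpleLieGroup G →
      letI : MeasurableSpace G := borel G; haveI : BorelSpace G := ⟨rfl⟩; ∀ r : LatticeRep G,
      ∃ κ₁ A σ C₁ β₀ : ℝ, 0 < κ₁ ∧ 0 < A ∧ 0 < σ ∧ ∀ β : ℝ, β₀ ≤ β → ∀ n : ℕ, 1 ≤ n → (n : ℝ) ≤ 2 * β ^ A →
      ∀ᶠ L : ℕ in atTop, ∃ (E' : Type) (_ : MeasurableSpace E') (Q : Measure E') (_ : IsProbabilityMeasure Q)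
        (X' Y' : E' → ℝ), Measurable X' ∧ Measurable Y' ∧ (∀ e, 0 ≤ X' e ∧ X' e ≤ 2 * r.N * β) ∧
        (∀ e, 0 ≤ Y' e ∧ Y' e ≤ 2 * r.N * β) ∧
        (∀ h : ℝ × ℝ → ℝ, Measurable h → (∀ z, |h z| ≤ 1) →
          |wilsonExpectation (L := L + 1) r.ρ β (toTorusObservable (L + 1) fun U =>
              h (β * plaqCost0 (d := 4) r.ρ 1 2 U, β * plaqCost0 (d := 4) r.ρ 1 2 (timeShiftLG (G := G) n U))) -
            ∫ e, h (X' e, Y' e) ∂Q| ≤ β ^ (-κ₁)) ∧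
        |(∫ e, X' e * Y' e ∂Q - (∫ e, X' e ∂Q) * (∫ e, Y' e ∂Q)) -
            σ * (curvaturePlaquetteCorr (d := 4) (by norm_num) (n : ℤ)) ^ 2| ≤ C₁ * β ^ (-κ₁) ∧
        Q.real {e | Real.log β ^ 2 + 1 < X' e} + Q.real {e | Real.log β ^ 2 + 1 < Y' e} ≤ β ^ (-(3 : ℝ))) :
    Summit.QuantumFields.YangMills.Theses.EntropyBudgetEquipartition.EntropyBudgetTransfer := by
  intro G _ _ _ _ hG
  letI : MeasurableSpace G := borel G
  haveI : BorelSpace G := ⟨rfl⟩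
  intro r _
  exact twoSidedLaw_of_referencePairs r (href G hG r)

end Summit.QuantumFields.YangMills.Theorems.EntropyBudgetEquipartition.CovTransfer

end
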